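import Summits.QuantumFields.YangMills.Theorems.UnitScaleTiltProp7SectET3WCurrentRealityLettersT3
import Summits.QuantumFields.YangMills.Theorems.UnitScaleTiltProp7ChartCentralT3
import Summits.QuantumFields.YangMills.Theorems.UnitScaleTiltProp7SectET3RealityPInvT3
import Literature.MathematicalPhysics.QuantumFieldTheory.Balaban1983to89.B11Eq80CurrentRealSubspace
import Literature.MathematicalPhysics.QuantumFieldTheory.Balaban1983to89.BlockAveragingSU2Complex
import HarnessLib

/-!
# Route `UnitScaleTilt`, crux K1 child «MinimiserStabilityRegPr» (stmt-QuantumFields-19200), stub `stub_existenceMinimalOrbit` (EX), route (α) — THE (W-X′) LETTERS OF RECORD: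
# **THE Sect. C CHART `T47 H̃ᴾ C̃ εC` KEEPS HERMITIAN READINGS ON ITS BALL** — ★px21 g3's displayed row `hPT` of ✓`Prop7Row84AtEtaSlotMember.hasDerivAt_actionZ_chartRay_real_member_eta` (:129,
# the (84) reader ✓p678874), at `U₀ ∈ 𝔘_k(ε₀)` in the windows `10⁹L²e ≤ 1`, `10¹²L³ε₀ ≤ 1`, GIVEN ONLY the Sect. C regime `RC` of `(H̃ᴾ, C̃)` at radius `c₄ := e∕2`

Cell `ym3-torus`, width seat `ym3-torus-px3` (gen 3; my bus line 2026-08-29T00:19Z (i) «HPT-AT-RECORD», EX namer ★w2-19200 g7 WORD (9) letters).  THEOREMS ONLY (0 `def`, 0 `sorry`); `--supports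
stmt-QuantumFields-19200 --as helper`; count-neutral.  YM₃ on T³ is a ladder rung (R3), NOT the Clay problem; nothing here claims the stub, the crux, d = 4 or the mass gap.

THE PRINT.  [Balaban1985Variational] (47)–(49) p. 285 (`A = A′ − HD(A′)`), (51) p. 286 «for A′ with values in 𝔤 the configuration D(A′) has values in 𝔤 also», (44) p. 285;
[Balaban1985BackgroundPropagators] (3.14) p. 393, p. 393 «The operators … are real».  MECHANISM: the Sect. C contraction runs inside the CLOSED real set of (115)-fields with HERMITIAN readings
(lit ✓`B11Eq80CurrentRealSubspace.Emap_apply_mem` at `S :=` {Hermitian}): `H̃ᴾ := H1f … DeltaPiSlotP … U₀` commutes with `X ↦ Xᴴ` (✓`Prop7H46Reality.H1f_star_comm` with the `QTwS` σ-row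
✓`QTwS_star_comm_of_regPr` and the slot σ-row ✓`DeltaPiSlotP_toL2_star_of_regPr`), and `C̃ := fun A′ ↦ (−I) • CmapTwS U₀ ((η·I) • ιA′)` maps every Hermitian reading `Y` of the ball `‖Y‖ < e∕2`
to Hermitian (indeed Hermitian traceless) block data: PEEL OFF THE CENTRE bondwise, `Y(b) = Y₀(b) + ½tr Y(b)·1` (`|½tr Y(b)| ≤ ‖Y(b)‖`, lit ✓`SU2Mean.norm_trace_le`), the central part does not move
the remainder (✓`Prop7SymAvgTwSym.CmapTwS_add_central_of_regPr` — (Z-C) ✓p681188; `Lᵏη = 1`, `160L·‖Y‖ ≤ 1` inside the ball), and on the `𝔰𝔲(2)` part the remainder is `𝔰𝔲(2)`-valued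
(✓`Prop7SectET3WCurrentRealityLetters.CmapTwS_skewHermitian_traceless_of_ball`).

WHAT IS PROVED (sorry-free, no definition).
* §1 [folklore] `isHermitian_sub_half_trace_smul_one'`-type bookkeeping: `herm_peel` (a Hermitian `X` splits as Hermitian traceless + `(½tr X)·1`, `‖½tr X‖ ≤ ‖X‖`, `‖X − (½tr X)·1‖ ≤ 2‖X‖`).
* §2 ★★ **`Ctilde_hermitian_of_ball`** — `C̃ Y` has Hermitian block values for every `Y` of the ball `‖Y‖ < e∕2` with Hermitian readings (at `U₀ ∈ 𝔘_k(ε₀)` in the two windows).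
* §3 ★★★ **`T47_hermitian_readings_at_record (ha) (hε₀ he hWe hWε) (U₀ hreg) (RC : Regime H̃ᴾ 0 C̃ bH 0 C₂ (e∕2) 0 aC εC)`** = ★px21's `hPT` binder VERBATIM (`∀ Y, ‖Y‖ < a_C → Hermitian readings →
  Hermitian readings of `T47 H̃ᴾ C̃ εC Y`), the regime's radius letter `c₄` READ AS `e∕2` (the (W-X′) constant of ✓p664073 ∕ ✓`…WCurrentRealityAtRecord`).
HONEST SCOPE.  Composition of landed theorems; `RC` stays displayed (N06-class through `norm_G = norm_H₁`); nothing of Props 3–4 asserted; the EX stub is not touched.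

References: T. Bałaban, CMP **102** (1985) 277–309 [Balaban1985Variational] ((44)–(51) pp.285–286, Prop. 6 p.295, (115) p.294); CMP **99** (1985) 389–434 [Balaban1985BackgroundPropagators]
((3.13)–(3.15) p.393, (3.126) p.420).
-/

set_option autoImplicit false

noncomputable section

open scoped InnerProductSpace ComplexConjugate Matrix.Norms.L2Operator BigOperators
open Metric Set Filter Topology

namespace Summit.QuantumFields.YangMills.Theorems.Prop7SectET3WChartHermitian

open Literature.MathematicalPhysics.QuantumFieldTheory.Balaban1983to89
open Literature.MathematicalPhysics.QuantumFieldTheory.Balaban1983to89.T3ContinuumYM3Torus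
open T3SectALandauChart (eta eta_pos)
open T3PrintedRegularMinimiser (RegPr)
open B9SectCLatticeCarrier (Bond)
open B11Eq115Space (NegSup NegSize Space115 JetSup levWeight)
open B11Eq111FrakG (nabla115)
open B11Eq174Chart (Regime)
open B11Eq80Current (Emap)
open B11Eq90V0GroupComposed (T47 T47_apply)
open B11Eq80CurrentRealSubspace (Emap_apply_mem)
open SU2Mean (norm_trace_le)
open Summit.QuantumFields.YangMills.Theorems.Prop7SectET3Transport (periodsT3 siteEquiv bondEquiv bgOfCfg levWeight_const_eq_one)
open Summit.QuantumFields.YangMills.Theorems.Prop7SectET3HilbertLetters (W₂ frobEquiv toL2)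
open Summit.QuantumFields.YangMills.Theorems.Prop7SectET3CurvedPropagators (H1f)
open Summit.QuantumFields.YangMills.Theorems.Prop7SectET3DeltaPiPInv (DeltaPiSlotP)
open Summit.QuantumFields.YangMills.Theorems.Prop7SymAvgTwSym (CmapTwS QTwS_star_comm_of_regPr CmapTwS_add_central_of_regPr)
open Summit.QuantumFields.YangMills.Theorems.Prop7H46Reality (H1f_star_comm)
open Summit.QuantumFields.YangMills.Theorems.Prop7SectET3RealityPInv (DeltaPiSlotP_toL2_star_of_regPr)
open Summit.QuantumFields.YangMills.Theorems.Prop7SectET3WCurrentRealityLetters (CmapTwS_skewHermitian_traceless_of_ball isHermitian_trace_zero_negI_smul skewHermitian_etaI_smul)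

/-! ## §1 Peeling off the centre of a Hermitian `2 × 2` matrix -/

/-- **A HERMITIAN `X ∈ M₂(ℂ)` IS (HERMITIAN TRACELESS) + (½tr X)·1**, with `‖½tr X‖ ≤ ‖X‖` and `‖X − (½tr X)·1‖ ≤ 2‖X‖` (operator norm; lit ✓`SU2Mean.norm_trace_le`). [folklore] -/
theorem herm_peel {X : Matrix (Fin 2) (Fin 2) ℂ} (hX : star X = X) :
    (X - ((2 : ℂ)⁻¹ * X.trace) • (1 : Matrix (Fin 2) (Fin 2) ℂ)).IsHermitian ∧ (X - ((2 : ℂ)⁻¹ * X.trace) • (1 : Matrix (Fin 2) (Fin 2) ℂ)).trace = 0 ∧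
      ‖(2 : ℂ)⁻¹ * X.trace‖ ≤ ‖X‖ ∧ ‖X - ((2 : ℂ)⁻¹ * X.trace) • (1 : Matrix (Fin 2) (Fin 2) ℂ)‖ ≤ 2 * ‖X‖ := by
  have hXh : X.IsHermitian := by rw [Matrix.IsHermitian, ← Matrix.star_eq_conjTranspose, hX]
  obtain ⟨h1, h2⟩ := Prop7SectET3WCurrentRealityLetters.isHermitian_trace_zero_sub_half_trace hXh
  have htr : ‖(2 : ℂ)⁻¹ * X.trace‖ ≤ ‖X‖ := by
    rw [norm_mul, norm_inv, RCLike.norm_ofNat]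
    have := norm_trace_le X
    linarith
  refine ⟨h1, h2, htr, ?_⟩
  calc ‖X - ((2 : ℂ)⁻¹ * X.trace) • (1 : Matrix (Fin 2) (Fin 2) ℂ)‖ ≤ ‖X‖ + ‖((2 : ℂ)⁻¹ * X.trace) • (1 : Matrix (Fin 2) (Fin 2) ℂ)‖ := norm_sub_le _ _
    _ = ‖X‖ + ‖(2 : ℂ)⁻¹ * X.trace‖ := by rw [norm_smul, CStarRing.norm_one, mul_one]
    _ ≤ 2 * ‖X‖ := by linarith

/-! ## §2 ★★ The (W-X′) chart remainder keeps Hermitian readings on the ball `‖Y‖ < e∕2` -/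

section T3

variable (F : T3Family) {n K : ℕ} (h : n ≤ K) [Fact (0 < (F.L : ℝ))] [Fact (0 < ((F.L : ℝ)⁻¹) ^ (K - n))]

/-- ★★ **`C̃ Y` IS HERMITIAN (TRACELESS) FOR EVERY HERMITIAN READING `Y` OF THE BALL `‖Y‖ < e∕2`** at `U₀ ∈ 𝔘_k(ε₀)` (`10⁹L²e ≤ 1`, `10¹²L³ε₀ ≤ 1`): peel off the centre bondwise (§1),
drop it by ✓`CmapTwS_add_central_of_regPr` (`A := (η·I)•Y₀`, `‖A‖ ≤ 2η‖Y‖ < ηe ≤ (10⁹L²)⁻¹η`; `z := η·½tr Y(b)`, `t := η‖Y‖`, `32ℓLᵏt = 160L‖Y‖ ≤ 1`), then ✓`CmapTwS_skewHermitian_traceless_of_ball`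
on the `𝔰𝔲(2)` part. [cite: Balaban1985Variational, (44) p.285, (51) p.286; Balaban1985BackgroundPropagators, (3.14) p.393] -/
theorem Ctilde_hermitian_of_ball {ε₀ e : ℝ} (hε₀ : 0 < ε₀) (he : 0 < e) (hWe : 10 ^ 9 * (F.L : ℝ) ^ 2 * e ≤ 1) (hWε : 10 ^ 12 * (F.L : ℝ) ^ 3 * ε₀ ≤ 1)
    (U₀ : GaugeField (F.P K) 0 (Matrix.specialUnitaryGroup (Fin 2) ℂ)) (hreg : RegPr F n K ε₀ U₀)
    (Y : Space115 (F.L : ℝ) (((F.L : ℝ)⁻¹) ^ (K - n)) (fun _ : Bond 3 (periodsT3 F K) => K - n)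
      (fun _ : Bond 3 (periodsT3 F K) × Fin 3 => K - n) (nabla115 (((F.L : ℝ)⁻¹) ^ (K - n)) (bgOfCfg F K U₀)))
    (hY : ‖Y‖ < e / 2) (hYh : ∀ b : PBond (F.P K) 0, star (JetSup.equiv _ _ _ Y (bondEquiv F K b)) = JetSup.equiv _ _ _ Y (bondEquiv F K b)) (c : PBond (F.P n) 0) :
    (((-Complex.I) • CmapTwS F n K h U₀ (((((eta F n K : ℝ) : ℂ)) * Complex.I) • fun b : PBond (F.P K) 0 => JetSup.equiv _ _ _ Y (bondEquiv F K b))) c).IsHermitian ∧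
    (((-Complex.I) • CmapTwS F n K h U₀ (((((eta F n K : ℝ) : ℂ)) * Complex.I) • fun b : PBond (F.P K) 0 => JetSup.equiv _ _ _ Y (bondEquiv F K b))) c).trace = 0 := by
  have hL : (F.L : ℝ) ≠ 0 := (Fact.out : 0 < (F.L : ℝ)).ne'
  have hLpos : (0 : ℝ) < F.L := Fact.out
  have hη : 0 < eta F n K := eta_pos F n K
  -- readings are below the (115)-norm (weights `1`)
  have hpt : ∀ b : PBond (F.P K) 0, ‖JetSup.equiv _ _ _ Y (bondEquiv F K b)‖ ≤ ‖Y‖ := fun b => by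
    have h1 := NegSup.norm_apply_le (JetSup.fst Y) (bondEquiv F K b)
    rw [JetSup.equiv_fst, levWeight_const_eq_one hL, inv_one, one_mul] at h1
    exact h1.trans (JetSup.norm_fst_le Y)
  -- the peeled letters
  set Yf : PBond (F.P K) 0 → Matrix (Fin 2) (Fin 2) ℂ := fun b => JetSup.equiv _ _ _ Y (bondEquiv F K b) with hYf
  set zc : PBond (F.P K) 0 → ℂ := fun b => (2 : ℂ)⁻¹ * (Yf b).trace with hzc
  set Y₀ : PBond (F.P K) 0 → Matrix (Fin 2) (Fin 2) ℂ := fun b => Yf b - zc b • (1 : Matrix (Fin 2) (Fin 2) ℂ) with hY₀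
  set A : PBond (F.P K) 0 → Matrix (Fin 2) (Fin 2) ℂ := ((((eta F n K : ℝ) : ℂ)) * Complex.I) • Y₀ with hAdef
  have hpeel : ∀ b, (Y₀ b).IsHermitian ∧ (Y₀ b).trace = 0 ∧ ‖zc b‖ ≤ ‖Yf b‖ ∧ ‖Y₀ b‖ ≤ 2 * ‖Yf b‖ := fun b => herm_peel (hYh b)
  -- `(η·I)•Yf = A + (I·(η·zc))•1`
  have hsplit : (((((eta F n K : ℝ) : ℂ)) * Complex.I) • Yf) = fun b => A b + (Complex.I * ((eta F n K : ℂ) * zc b)) • (1 : Matrix (Fin 2) (Fin 2) ℂ) := by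
    funext b
    rw [hAdef, Pi.smul_apply, Pi.smul_apply, hY₀]
    simp only
    rw [smul_sub, smul_smul, show Complex.I * (((eta F n K : ℝ) : ℂ) * zc b) = ((eta F n K : ℝ) : ℂ) * Complex.I * zc b by ring, sub_add_cancel]
  -- sizes: `‖A b‖ ≤ 2η‖Y‖`, `‖η·zc b‖ ≤ η‖Y‖`
  have hAb : ∀ b, ‖A b‖ ≤ 2 * (eta F n K * ‖Y‖) := fun b => by
    rw [hAdef, Pi.smul_apply, norm_smul, norm_mul, Complex.norm_real, Complex.norm_I, mul_one, Real.norm_of_nonneg hη.le]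
    calc eta F n K * ‖Y₀ b‖ ≤ eta F n K * (2 * ‖Yf b‖) := mul_le_mul_of_nonneg_left (hpeel b).2.2.2 hη.le
      _ ≤ eta F n K * (2 * ‖Y‖) := by gcongr; exact hpt b
      _ = 2 * (eta F n K * ‖Y‖) := by ring
  have hzb : ∀ b, ‖(eta F n K : ℂ) * zc b‖ ≤ eta F n K * ‖Y‖ := fun b => by
    rw [norm_mul, Complex.norm_real, Real.norm_of_nonneg hη.le]
    exact mul_le_mul_of_nonneg_left ((hpeel b).2.2.1.trans (hpt b)) hη.le
  have hpos : (0 : ℝ) < 10 ^ 9 * (F.L : ℝ) ^ 2 := by positivity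
  have he' : e ≤ (10 ^ 9 * (F.L : ℝ) ^ 2)⁻¹ := by
    rw [le_inv_comm₀ he hpos]
    calc 10 ^ 9 * (F.L : ℝ) ^ 2 = (10 ^ 9 * (F.L : ℝ) ^ 2 * e) * e⁻¹ := by field_simp
      _ ≤ 1 * e⁻¹ := mul_le_mul_of_nonneg_right hWe (inv_nonneg.2 he.le)
      _ = e⁻¹ := one_mul _
  have hAn : ‖A‖ < (10 ^ 9 * (F.L : ℝ) ^ 2)⁻¹ * eta F n K := by
    have h1 : ‖A‖ ≤ 2 * (eta F n K * ‖Y‖) := (pi_norm_le_iff_of_nonneg (by positivity)).2 hAb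
    calc ‖A‖ ≤ 2 * (eta F n K * ‖Y‖) := h1
      _ < 2 * (eta F n K * (e / 2)) := by gcongr
      _ = eta F n K * e := by ring
      _ ≤ eta F n K * (10 ^ 9 * (F.L : ℝ) ^ 2)⁻¹ := mul_le_mul_of_nonneg_left he' hη.le
      _ = (10 ^ 9 * (F.L : ℝ) ^ 2)⁻¹ * eta F n K := mul_comm _ _
  have hAe : ∀ b, ‖A b‖ ≤ e * eta F n K := fun b => by
    have : 2 * (eta F n K * ‖Y‖) ≤ e * eta F n K := by nlinarith [hY.le, hη.le]
    exact (hAb b).trans this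
  -- the window `32ℓLᵏt ≤ 1` at `t := η‖Y‖` (`Lᵏη = 1`, `ℓ = 5L`, `160L‖Y‖ ≤ 80Le ≤ 10⁹L²e ≤ 1`)
  have hd : (F.P K).d = 3 := T3Family.P_d F K
  have hLL : ((F.P K).L : ℝ) = F.L := rfl
  have hL1 : (1 : ℝ) ≤ F.L := by
    have hL3 : 3 ≤ F.L := by obtain ⟨a', ha'⟩ := F.hL.1; have := F.hL.2; omega
    exact_mod_cast (show 1 ≤ F.L by omega)
  have hLη : ((F.P K).L : ℝ) ^ (K - n) * eta F n K = 1 := by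
    rw [hLL, show eta F n K = ((F.L : ℝ)⁻¹) ^ (K - n) from rfl, ← mul_pow, mul_inv_cancel₀ hL, one_pow]
  have hsmall : 32 * ((((F.P K).d + 2) * (F.P K).L : ℕ) : ℝ) * (((F.P K).L : ℝ) ^ (K - n) * (eta F n K * ‖Y‖)) ≤ 1 := by
    have hℓ : ((((F.P K).d + 2) * (F.P K).L : ℕ) : ℝ) = 5 * (F.L : ℝ) := by rw [hd, ← hLL]; push_cast; ring
    rw [hℓ, ← mul_assoc (((F.P K).L : ℝ) ^ (K - n)), hLη, one_mul]
    have h1 : (F.L : ℝ) * ‖Y‖ ≤ (F.L : ℝ) * (e / 2) := mul_le_mul_of_nonneg_left hY.le hLpos.le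
    have h2 : (F.L : ℝ) * e ≤ (F.L : ℝ) ^ 2 * e := mul_le_mul_of_nonneg_right (by nlinarith) he.le
    nlinarith
  have key : CmapTwS F n K h U₀ (((((eta F n K : ℝ) : ℂ)) * Complex.I) • Yf) = CmapTwS F n K h U₀ A := by
    rw [hsplit]
    exact CmapTwS_add_central_of_regPr F h hε₀ hWε U₀ hreg A hAn (fun b => (eta F n K : ℂ) * zc b) (by positivity) hsmall hzb
  -- the `𝔰𝔲(2)` part
  have hsk : ∀ b, star (A b) = -A b ∧ (A b).trace = 0 := fun b => by
    rw [hAdef, Pi.smul_apply]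
    exact skewHermitian_etaI_smul ⟨(hpeel b).1, (hpeel b).2.1⟩ (eta F n K)
  have hC := CmapTwS_skewHermitian_traceless_of_ball F h hε₀ he hWe hWε U₀ hreg A hsk hAe c
  rw [Pi.smul_apply, key]
  exact isHermitian_trace_zero_negI_smul hC

/-! ## §3 ★★★ The displayed row `hPT` at the letters of record -/

variable (c₀ cB a : ℝ) [Fact (0 < c₀)] [Fact (0 < cB)]

/-- ★★★ **★px21's DISPLAYED ROW `hPT` OF THE (84) READER, AT THE (W-X′) LETTERS OF RECORD** (`H̃ᴾ := H1f … DeltaPiSlotP … U₀`, `C̃ := fun A′ ↦ (−I) • CmapTwS U₀ ((η·I) • ιA′)`, the Sect. C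
regime's radius letter `c₄` read as `e∕2`): at `U₀ ∈ 𝔘_k(ε₀)` in the windows, for `0 ≤ a`, every `Y` of the ball `‖Y‖ < a_C` with Hermitian readings has a `T47 H̃ᴾ C̃ εC Y` with Hermitian readings —
lit ✓`Emap_apply_mem` at `S :=` {Hermitian} with `hC := Ctilde_hermitian_of_ball` and `hH :=` ✓`H1f_star_comm` (σ-rows ✓`QTwS_star_comm_of_regPr`, ✓`DeltaPiSlotP_toL2_star_of_regPr`), and `T47 = id − HD`.
[cite: Balaban1985Variational, (47)–(49) p.285, (51) p.286, Prop. 6 p.295; Balaban1985BackgroundPropagators, (3.126) p.420, p.393] -/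
theorem T47_hermitian_readings_at_record (ha : 0 ≤ a)
    {ε₀ e : ℝ} (hε₀ : 0 < ε₀) (he : 0 < e) (hWe : 10 ^ 9 * (F.L : ℝ) ^ 2 * e ≤ 1) (hWε : 10 ^ 12 * (F.L : ℝ) ^ 3 * ε₀ ≤ 1)
    (U₀ : GaugeField (F.P K) 0 (Matrix.specialUnitaryGroup (Fin 2) ℂ)) (hreg : RegPr F n K ε₀ U₀)
    {bH C₂ aC εC : ℝ}
    (RC : Regime (H1f F n K h c₀ cB a (DeltaPiSlotP F n K h c₀ cB a) U₀) 0
      (fun A' : Space115 (F.L : ℝ) (((F.L : ℝ)⁻¹) ^ (K - n)) (fun _ : Bond 3 (periodsT3 F K) => K - n)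
        (fun _ : Bond 3 (periodsT3 F K) × Fin 3 => K - n) (nabla115 (((F.L : ℝ)⁻¹) ^ (K - n)) (bgOfCfg F K U₀)) =>
          (-Complex.I) • CmapTwS F n K h U₀ (((((eta F n K : ℝ) : ℂ)) * Complex.I) • fun b : PBond (F.P K) 0 => JetSup.equiv _ _ _ A' (bondEquiv F K b)))
      bH 0 C₂ (e / 2) 0 aC εC) :
    ∀ Y : Space115 (F.L : ℝ) (((F.L : ℝ)⁻¹) ^ (K - n)) (fun _ : Bond 3 (periodsT3 F K) => K - n) (fun _ : Bond 3 (periodsT3 F K) × Fin 3 => K - n)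
        (nabla115 (((F.L : ℝ)⁻¹) ^ (K - n)) (bgOfCfg F K U₀)), ‖Y‖ < aC →
      (∀ b : PBond (F.P K) 0, star (JetSup.equiv _ _ _ Y (bondEquiv F K b)) = JetSup.equiv _ _ _ Y (bondEquiv F K b)) →
      ∀ b : PBond (F.P K) 0,
        star (JetSup.equiv _ _ _ (T47 (H1f F n K h c₀ cB a (DeltaPiSlotP F n K h c₀ cB a) U₀)
            (fun A' : Space115 (F.L : ℝ) (((F.L : ℝ)⁻¹) ^ (K - n)) (fun _ : Bond 3 (periodsT3 F K) => K - n) (fun _ : Bond 3 (periodsT3 F K) × Fin 3 => K - n)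
                (nabla115 (((F.L : ℝ)⁻¹) ^ (K - n)) (bgOfCfg F K U₀)) =>
              (-Complex.I) • CmapTwS F n K h U₀ (((((eta F n K : ℝ) : ℂ)) * Complex.I) • fun b : PBond (F.P K) 0 => JetSup.equiv _ _ _ A' (bondEquiv F K b))) εC Y)
            (bondEquiv F K b))
          = JetSup.equiv _ _ _ (T47 (H1f F n K h c₀ cB a (DeltaPiSlotP F n K h c₀ cB a) U₀)
            (fun A' : Space115 (F.L : ℝ) (((F.L : ℝ)⁻¹) ^ (K - n)) (fun _ : Bond 3 (periodsT3 F K) => K - n) (fun _ : Bond 3 (periodsT3 F K) × Fin 3 => K - n)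
                (nabla115 (((F.L : ℝ)⁻¹) ^ (K - n)) (bgOfCfg F K U₀)) =>
              (-Complex.I) • CmapTwS F n K h U₀ (((((eta F n K : ℝ) : ℂ)) * Complex.I) • fun b : PBond (F.P K) 0 => JetSup.equiv _ _ _ A' (bondEquiv F K b))) εC Y)
            (bondEquiv F K b) := by
  intro Y hYa hYh b
  -- the Hermitian sectors
  let S : Submodule ℝ (Matrix (Fin 2) (Fin 2) ℂ) :=
    { carrier := {X | star X = X}
      add_mem' := fun {X Y} hX hY => by show star (X + Y) = X + Y; rw [star_add, hX, hY]
      zero_mem' := star_zero _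
      smul_mem' := fun r X hX => by show star (r • X) = r • X; rw [star_smul, star_trivial, hX] }
  let SX : Submodule ℝ (PBond (F.P n) 0 → Matrix (Fin 2) (Fin 2) ℂ) :=
    { carrier := {B | ∀ c, star (B c) = B c}
      add_mem' := fun {X Y} hX hY c => by rw [Pi.add_apply, star_add, hX c, hY c]
      zero_mem' := fun c => star_zero _
      smul_mem' := fun r X hX c => by rw [Pi.smul_apply, star_smul, star_trivial, hX c] }
  have hC : ∀ Y' : Space115 (F.L : ℝ) (((F.L : ℝ)⁻¹) ^ (K - n)) (fun _ : Bond 3 (periodsT3 F K) => K - n) (fun _ : Bond 3 (periodsT3 F K) × Fin 3 => K - n)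
      (nabla115 (((F.L : ℝ)⁻¹) ^ (K - n)) (bgOfCfg F K U₀)), ‖Y'‖ < e / 2 → (∀ b', JetSup.equiv _ _ _ Y' b' ∈ S) →
      ((-Complex.I) • CmapTwS F n K h U₀ (((((eta F n K : ℝ) : ℂ)) * Complex.I) • fun b : PBond (F.P K) 0 => JetSup.equiv _ _ _ Y' (bondEquiv F K b))) ∈ SX := by
    intro Y' hY' hY'S c
    have hYh' : ∀ b' : PBond (F.P K) 0, star (JetSup.equiv _ _ _ Y' (bondEquiv F K b')) = JetSup.equiv _ _ _ Y' (bondEquiv F K b') := fun b' => hY'S (bondEquiv F K b')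
    have h1 := (Ctilde_hermitian_of_ball F h hε₀ he hWe hWε U₀ hreg Y' hY' hYh' c).1
    show star (((-Complex.I) • CmapTwS F n K h U₀ (((((eta F n K : ℝ) : ℂ)) * Complex.I) • fun b : PBond (F.P K) 0 => JetSup.equiv _ _ _ Y' (bondEquiv F K b))) c) = _
    rw [Matrix.star_eq_conjTranspose]
    exact h1.eq
  have hH : ∀ X ∈ SX, ∀ b' : Bond 3 (periodsT3 F K), JetSup.equiv _ _ _ (H1f F n K h c₀ cB a (DeltaPiSlotP F n K h c₀ cB a) U₀ X) b' ∈ S := by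
    intro X hX b'
    have hXs : star X = X := funext fun c => hX c
    have key := H1f_star_comm F n K h c₀ cB a (DeltaPiSlotP F n K h c₀ cB a) U₀ (QTwS_star_comm_of_regPr F h hε₀ he hWe hWε U₀ hreg)
      (DeltaPiSlotP_toL2_star_of_regPr F n K h c₀ cB a U₀ ha hε₀ he hWe hWε hreg) X b'
    rw [hXs] at key
    show star (JetSup.equiv _ _ _ (H1f F n K h c₀ cB a (DeltaPiSlotP F n K h c₀ cB a) U₀ X) b') = _
    exact key.symm
  have hA'S : ∀ b' : Bond 3 (periodsT3 F K), JetSup.equiv _ _ _ Y b' ∈ S := fun b' => by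
    have h1 := hYh ((bondEquiv F K).symm b')
    rw [Equiv.apply_symm_apply] at h1
    exact h1
  have hmem := Emap_apply_mem RC S SX hC hH hYa hA'S (bondEquiv F K b)
  have hE : star (JetSup.equiv _ _ _ (Emap (H1f F n K h c₀ cB a (DeltaPiSlotP F n K h c₀ cB a) U₀)
      (fun A' : Space115 (F.L : ℝ) (((F.L : ℝ)⁻¹) ^ (K - n)) (fun _ : Bond 3 (periodsT3 F K) => K - n) (fun _ : Bond 3 (periodsT3 F K) × Fin 3 => K - n)
          (nabla115 (((F.L : ℝ)⁻¹) ^ (K - n)) (bgOfCfg F K U₀)) =>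
        (-Complex.I) • CmapTwS F n K h U₀ (((((eta F n K : ℝ) : ℂ)) * Complex.I) • fun b : PBond (F.P K) 0 => JetSup.equiv _ _ _ A' (bondEquiv F K b))) εC Y) (bondEquiv F K b))
      = JetSup.equiv _ _ _ (Emap (H1f F n K h c₀ cB a (DeltaPiSlotP F n K h c₀ cB a) U₀)
      (fun A' : Space115 (F.L : ℝ) (((F.L : ℝ)⁻¹) ^ (K - n)) (fun _ : Bond 3 (periodsT3 F K) => K - n) (fun _ : Bond 3 (periodsT3 F K) × Fin 3 => K - n)
          (nabla115 (((F.L : ℝ)⁻¹) ^ (K - n)) (bgOfCfg F K U₀)) =>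
        (-Complex.I) • CmapTwS F n K h U₀ (((((eta F n K : ℝ) : ℂ)) * Complex.I) • fun b : PBond (F.P K) 0 => JetSup.equiv _ _ _ A' (bondEquiv F K b))) εC Y) (bondEquiv F K b) := hmem
  -- `T47 Y = Y + solA = Y − HD(Y)`
  rw [T47_apply]
  have hsol : ∀ (A' : Space115 (F.L : ℝ) (((F.L : ℝ)⁻¹) ^ (K - n)) (fun _ : Bond 3 (periodsT3 F K) => K - n) (fun _ : Bond 3 (periodsT3 F K) × Fin 3 => K - n)
      (nabla115 (((F.L : ℝ)⁻¹) ^ (K - n)) (bgOfCfg F K U₀))),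
      B11Eq174Chart.solA (H1f F n K h c₀ cB a (DeltaPiSlotP F n K h c₀ cB a) U₀) 0
        (fun A' : Space115 (F.L : ℝ) (((F.L : ℝ)⁻¹) ^ (K - n)) (fun _ : Bond 3 (periodsT3 F K) => K - n) (fun _ : Bond 3 (periodsT3 F K) × Fin 3 => K - n)
            (nabla115 (((F.L : ℝ)⁻¹) ^ (K - n)) (bgOfCfg F K U₀)) =>
          (-Complex.I) • CmapTwS F n K h U₀ (((((eta F n K : ℝ) : ℂ)) * Complex.I) • fun b : PBond (F.P K) 0 => JetSup.equiv _ _ _ A' (bondEquiv F K b))) 0 εC A'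
      = -Emap (H1f F n K h c₀ cB a (DeltaPiSlotP F n K h c₀ cB a) U₀)
        (fun A' : Space115 (F.L : ℝ) (((F.L : ℝ)⁻¹) ^ (K - n)) (fun _ : Bond 3 (periodsT3 F K) => K - n) (fun _ : Bond 3 (periodsT3 F K) × Fin 3 => K - n)
            (nabla115 (((F.L : ℝ)⁻¹) ^ (K - n)) (bgOfCfg F K U₀)) =>
          (-Complex.I) • CmapTwS F n K h U₀ (((((eta F n K : ℝ) : ℂ)) * Complex.I) • fun b : PBond (F.P K) 0 => JetSup.equiv _ _ _ A' (bondEquiv F K b))) εC A' := fun A' => by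
    simp only [Emap, neg_neg]
  rw [hsol, ← sub_eq_add_neg, JetSup.equiv_sub, Pi.sub_apply, star_sub, hYh b, hE]

end T3

end Summit.QuantumFields.YangMills.Theorems.Prop7SectET3WChartHermitian

end
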